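import Summits.ABC.IUTFork.Repair.RLana91OrderVariantArchCorner
import Summits.ABC.IUTFork.Repair.RLana91ContainerGrain
import HarnessLib

/-!
# REPAIR-CATALOGUE row RC-639, horn (H2) «the value-group part on the input side may exert some influence on the output» at the HONEST-ARCHIMEDEAN
# genuine sharp bed: (9-1) as typed ⟺ the output's own Kummer images have procession volume `−|log q|` (Step (x)), and the q-MOVER output —
# which realises (9-1) at the trivial-`∞` bed — NO LONGER does (it realises the ORDER variant instead) (D-0123 (C); seat abc-iut-rcat-tst-9 gen 5)

PROOF-ONLY file (D-0012; no definition, no `Prop` fact; class `Lana`, rows RC-639 / RC-130 / RC-667; rung LADDER-ABC:A2; companion of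
`Repair.RLana91InputConstruction` (gen 2, p518179), `Repair.RLana91ArchCorner`, `Repair.RLana91OrderVariantArchCorner`). TAKES NO SIDE on [IUTchIII]
Cor. 3.12 / [IUTchIV] Thm. 1.10, on the LANA authors, or on any author or repository; nothing here asserts abc proved or refuted; decided-as-typed ≠
decided-in-print. Row RC-639 (H2)'s word of record (p518179, abc-iut-c312-7's `settingPrVolSharp`, TRIVIAL archimedean container): a FAITHFUL
construction `C : q-ideles ↦ Θ-ideles` (output realising `P_Θ`) carries no influence and (9-1) as typed is false at every input; (9-1) is TRUE iff the
output's Kummer images have procession volume `−|log q|` (`H_settingPrVolSharp_iff_kummerImage`), realised by the NORM-TRANSFER / q-MOVER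
constructions `‖t_{Θ,j,v}‖ = ‖t_{q,v}‖` (`H_settingPrVolSharp_of_norm_eq`, `H_settingPrVolSharp_qMover`). THIS FILE re-evaluates the horn at the
same print-normalised container WITH THE HONEST ARCHIMEDEAN PLACE (abc-iut-c312-7 gen 3's `settingPrVolArchSharp` over abc-iut-w5-d163's `∞`-model:
Θ-boxes `π^{j+1}·B` of log-volume `(j+1)·log π`, `q`-volume `0` at `∞`), for ARBITRARY non-zero output ideles `t` (no realising hypothesis on `t`).

WHAT IS PROVED. `H_settingPrVolArchSharp_iff_kummerImage` — for ANY non-zero output ideles, (9-1) as typed at an input ⟺ the procession-normalised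
volume of the output's own Kummer images is `−|log q|` (Step (x) volume-invariance of the merged container, abc-iut-c312-7
`adm_and_logvol_possibleImage_eq_PrArch`, through the container-parametric reduction `RLana91ContainerGrain.H_iff_thetaRegion3_of_stepX`);
`finsum_logvol_thetaRegion_settingPrVolArchSharp_of_norm_eq`, `processionNormalized_thetaRegion_settingPrVolArchSharp_of_norm_eq` — for
NORM-TRANSFER output (`‖t_{Θ,j,v}‖ = ‖t_{q,v}‖` at every label and place; the q-mover `j ↦ t_q` is the instance) the Kummer images ARE the q-pilot
regions at every prime (abc-iut-c312-7 `thetaRegion_eq_qRegion_settingPrVolSharp_of_norm_eq`) and carry `|S^±_{j+1}|·log π` at `∞`, so their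
procession volume is `−|log q| + ((l+5)/4)·log π`; **`not_H_settingPrVolArchSharp_of_norm_eq`** — hence (9-1) as typed is FALSE for every
norm-transfer output at every input (`((l+5)/4)·log π > 0`) — the honest-`∞` NEGATION of p518179's `H_settingPrVolSharp_of_norm_eq`;
**`orderVariant_settingPrVolArchSharp_of_norm_eq`** — while the ORDER variant `−|log q| ≤ vol(U)` HOLDS for that output at every input, on ALL pilot
data (shallow or deep); `orderVariant_and_not_H_settingPrVolArchSharp_of_norm_eq` — the pair.

READING for the catalogue (numbers and decl names, not adjectives; no side). RC-639 (H2) at the honest-`∞` bed: faithful constructions — (9-1) false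
at every input (`RLana91ArchCorner.not_H_settingPrVolArchSharp`, Lindemann); general constructions — (9-1) ⟺ «output Kummer volume = −|log q|»
(this file), a CONSTRAINT on `C`; the norm-transfer/q-mover door, OPEN for (9-1) at the trivial-`∞` bed (p518179), is SHUT for (9-1) at the
honest-`∞` bed by the archimedean Θ-term and opens instead onto the ORDER variant (RC-667), uniformly in the data — so at honest `∞` the order
variant is realised (i) by faithful output exactly on SHALLOW data (`RLana91OrderVariantArchCorner`) and (ii) by q-mover output on ALL data.
Whether SOME `p`-adic idele output realises (9-1) as typed at the honest-`∞` bed is NOT decided here (it would need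
`Σ_v c_v·log|κ(v)| = ((l+5)/4)·log π` with rational `c_v` from the value groups — a Lindemann-type question; UNTESTED(needs typing: value group of
abc-iut-S7's `RescaledCompletion` norms)). HONEST SCOPE: statements about OUR typed objects at OUR beds (w5-d163's MODEL of the `∞`-boxes;
c312-7's sharp setting reads regions off ideles through their norms); LANA records the (H2) point as open among its members (Rmk. 6.2.2
p. 34 l. 8–9) — decided-as-typed ≠ decided-in-print; typed ≠ proved; instantiated ≠ endorsed.
[cite: LANA2026Report, Rmk. 6.2.2 p. 33–34; §8.2 (SHE) p. 42; §9.2 (9-1) p. 46] [cite: Mochizuki2012, IUTchIII Cor. 3.12 p. 173–174; proof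
Step (x) p. 181] [cite: Mochizuki2012, IUTchIV Thm. 1.10 proof Step (vii) p. 30] [cite: DupuyHilado2025, §3.3, §3.4, §3.7, §3.9, Thm. 3.10.1]
[claim: Mochizuki2012, status: disputed] for every quoted construction.
-/

noncomputable section

open Set Function NumberField IsDedekindDomain

namespace Summit.ABC.IUTFork.Repair.RLana91InputConstructionArchCorner

open Thm311 Thm311.Real Cor312 Cor312Vol Literature.IUT.LogThetaLattice Literature.IUT.LogVolume Literature.IUT.HodgeTheaters
  Literature.NumberTheory.NumberFields RLana91OrderVariant RLana91ArchCorner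

section GenuineArch

variable {F : Type} [Field F] [NumberField F] (X : PilotData F) {logv : PadicLogs F} (hlog : LogvAnalytic logv)
  (hc : ∀ w : InfinitePlace F, w.IsComplex) (M : Type) [Field M] [NumberField M]
  (archPk : ∀ (j : (thetaIndex X).Label) (vQ : (thetaIndex X).VQ), Set ((logShellsDH X logv).Packet j vQ))
  (archSub : ∀ (j : (thetaIndex X).Label) (v : (thetaIndex X).V),
    Set ((logShellsDH X logv).Packet j ((thetaIndex X).over v)))
  (Ψ : ℤ → ∀ v : (thetaIndex X).V, v ∈ (thetaIndex X).Vbad → Set ((logShellsDH X logv).StarPacket v))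
  (act : ℤ → ∀ v : (thetaIndex X).V, v ∈ (thetaIndex X).Vbad →
    (logShellsDH X logv).StarPacket v → Module.End ℚ ((logShellsDH X logv).StarPacket v))
  (Mmod : ℤ → ∀ j : (thetaIndex X).LabelStar, Set ((logShellsDH X logv).GlobalPacket j.1))
  (region : ℤ → ∀ j : (thetaIndex X).LabelStar, FinDivisor M → ∀ vQ : (thetaIndex X).VQ,
    Set ((logShellsDH X logv).Packet j.1 vQ))
  (frobAdm : ℤ → ℤ → ∀ (j : (thetaIndex X).Label) (vQ : (thetaIndex X).VQ),
    Set ((logShellsDH X logv).Packet j vQ) → Prop)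
  (frobLogvol : ℤ → ℤ → ∀ (j : (thetaIndex X).Label) (vQ : (thetaIndex X).VQ),
    Set ((logShellsDH X logv).Packet j vQ) → ℝ)
  (frobΨ : ℤ → ℤ → ∀ v : (thetaIndex X).V, v ∈ (thetaIndex X).Vbad → Set ((logShellsDH X logv).StarPacket v))
  (frobMmod : ℤ → ℤ → ∀ j : (thetaIndex X).LabelStar, Set ((logShellsDH X logv).GlobalPacket j.1))
  (unitImage : ℤ → ℤ → ℕ → ∀ (j : (thetaIndex X).Label) (vQ : (thetaIndex X).VQ),
    Set ((logShellsDH X logv).Packet j vQ))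
  (ballImage : ℤ → ℤ → ∀ (j : (thetaIndex X).Label) (vQ : (thetaIndex X).VQ),
    Set ((logShellsDH X logv).Packet j vQ))
  (thetaDiv : ℤ → ℤ → LgpDivisor M (thetaIndex X).lstar)
  (n : ℤ) {HT : Type} {LogLink : HT → HT → Type} {IsFull : ∀ {s t : HT}, LogLink s t → Prop}
  (lat : LGPGaussianLogThetaLattice LogLink IsFull)
  {Frd : Type} {IsoF : Frd → Frd → Type} {Ob : Frd → Type} {realify : Frd → Frd} {Strip : Type}
  {IsoS : Strip → Strip → Type} {Mv : ∀ v : (thetaIndex X).V, v ∈ (thetaIndex X).Vbad → Type}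
  [∀ v h, Monoid (Mv v h)]
  (sig : GlobalLGPFrobenioidSignature (thetaIndex X).lstar (thetaIndex X).V (· ∈ (thetaIndex X).Vbad)
    Frd IsoF Ob realify Strip IsoS Mv)
  (split : SplittingMonoids Mv) {ObΔ : Type} {N : ∀ v : (thetaIndex X).V, v ∈ (thetaIndex X).Vbad → Type}
  [∀ v h, Monoid (N v h)] (qData : QPilotData ObΔ N)
  (t : ∀ (pp : Nat.Primes) (_ : Fin X.lstar) (x : (thetaIndex X).Fibre (.inr pp)),
    haveI : Fact (pp : ℕ).Prime := ⟨pp.2⟩; kOf X pp.1 x)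
  (tq : ∀ (pp : Nat.Primes) (x : (thetaIndex X).Fibre (.inr pp)), haveI : Fact (pp : ℕ).Prime := ⟨pp.2⟩; kOf X pp.1 x)
  (ρ : (∀ v : (thetaIndex X).V, v ∈ (thetaIndex X).Vbad → Set ((logShellsDH X logv).StarPacket v)) →
    ∀ (j : (thetaIndex X).Label) (vQ : (thetaIndex X).VQ), Set ((logShellsDH X logv).Packet j vQ))
  (qK : ∀ v : (thetaIndex X).V, v ∈ (thetaIndex X).Vbad → Set ((logShellsDH X logv).StarPacket v))

/-! ## §1. The general construction: (9-1) as typed ⟺ the output's Kummer images have procession volume `−|log q|` -/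

/-- **For ANY non-zero output ideles `t`, (9-1) as typed at the fourth corner ⟺ the output's own Kummer images have procession-normalised
volume `−|log q|`** — Step (x) volume-invariance of the merged container (every possible image has the volume of the sharp Kummer image,
`RLana91ArchCorner.logvol_eq_of_mem_possibleImages_settingPrVolArchSharp`) through the container-parametric reduction
`RLana91ContainerGrain.H_iff_thetaRegion3_of_stepX`; the honest-`∞` twin of gen 2's `RLana91InputConstruction.H_settingPrVolSharp_iff_kummerImage`.
[cite: Mochizuki2012, IUTchIII Cor. 3.12 proof Step (x) p. 181] [cite: LANA2026Report, §9.2 (9-1) p. 46] -/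
theorem H_settingPrVolArchSharp_iff_kummerImage (ht0 : ∀ pp i x, t pp i x ≠ 0) (htq0 : ∀ pp x, tq pp x ≠ 0)
    (htq1 : ∀ (pp : Nat.Primes) (x : (thetaIndex X).Fibre (.inr pp)),
      haveI : Fact (pp : ℕ).Prime := ⟨pp.2⟩; placeOf X pp.1 x ∉ X.S → ‖tq pp x‖ = 1) :
    Repair.CandLana1.H
      (LatticeSituation.ofShells (logShellsDH X logv) M archPk archSub (summandPiecesPrArch X hlog hc).Adm
        (summandPiecesPrArch X hlog hc).logvol Ψ act Mmod region frobAdm frobLogvol frobΨ frobMmod unitImage ballImage thetaDiv)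
      (settingPrVolArchSharp X hlog hc M archPk archSub Ψ act Mmod region n lat sig split qData t tq htq0 htq1) ρ qK ↔
      processionNormalized (fun i : Fin (thetaIndex X).lstar => ∑ᶠ vQ : (thetaIndex X).VQ,
        ((situationDHVolPrArch X hlog hc M archPk archSub Ψ act Mmod region).D n).logvol (Setting.labelSucc i) vQ
          ((settingPrVolArchSharp X hlog hc M archPk archSub Ψ act Mmod region n lat sig split qData t tq htq0 htq1).thetaRegion 0
            (Setting.labelSucc i) vQ)) =
        (settingPrVolArchSharp X hlog hc M archPk archSub Ψ act Mmod region n lat sig split qData t tq htq0 htq1).negLogQ := by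
  -- rewrite the Kummer family `thetaRegion 0` as the (Ind3)-enlarged region `thetaRegion3` (position-independent boxes)
  have h3 : (fun i : Fin (thetaIndex X).lstar => ∑ᶠ vQ : (thetaIndex X).VQ,
        ((situationDHVolPrArch X hlog hc M archPk archSub Ψ act Mmod region).D n).logvol (Setting.labelSucc i) vQ
          ((settingPrVolArchSharp X hlog hc M archPk archSub Ψ act Mmod region n lat sig split qData t tq htq0 htq1).thetaRegion3
            (Setting.labelSucc i) vQ)) =
      fun i : Fin (thetaIndex X).lstar => ∑ᶠ vQ : (thetaIndex X).VQ,
        ((situationDHVolPrArch X hlog hc M archPk archSub Ψ act Mmod region).D n).logvol (Setting.labelSucc i) vQ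
          ((settingPrVolArchSharp X hlog hc M archPk archSub Ψ act Mmod region n lat sig split qData t tq htq0 htq1).thetaRegion 0
            (Setting.labelSucc i) vQ) := by
    funext i
    refine finsum_congr fun vQ => ?_
    rw [thetaRegion3_settingPrVolArchSharp_eq X hlog hc M archPk archSub Ψ act Mmod region n lat sig split qData t tq htq0 htq1 0]
  have hx : ∀ (i : Fin (thetaIndex X).lstar) (vQ : (thetaIndex X).VQ)
      (U : Set ((logShellsDH X logv).Packet (Setting.labelSucc i) vQ)),
      U ∈ (settingPrVolArchSharp X hlog hc M archPk archSub Ψ act Mmod region n lat sig split qData t tq htq0 htq1).possibleImages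
        (Setting.labelSucc i) vQ →
      ((situationDHVolPrArch X hlog hc M archPk archSub Ψ act Mmod region).D n).logvol (Setting.labelSucc i) vQ U =
        ((situationDHVolPrArch X hlog hc M archPk archSub Ψ act Mmod region).D n).logvol (Setting.labelSucc i) vQ
          ((settingPrVolArchSharp X hlog hc M archPk archSub Ψ act Mmod region n lat sig split qData t tq htq0 htq1).thetaRegion3
            (Setting.labelSucc i) vQ) := by
    intro i vQ U hU
    rw [thetaRegion3_settingPrVolArchSharp_eq X hlog hc M archPk archSub Ψ act Mmod region n lat sig split qData t tq htq0 htq1 0]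
    exact logvol_eq_of_mem_possibleImages_settingPrVolArchSharp X hlog hc M archPk archSub Ψ act Mmod region n lat sig split qData t tq
      ht0 htq0 htq1 i vQ hU
  refine (RLana91ContainerGrain.H_iff_thetaRegion3_of_stepX
    (LatticeSituation.ofShells (logShellsDH X logv) M archPk archSub (summandPiecesPrArch X hlog hc).Adm
      (summandPiecesPrArch X hlog hc).logvol Ψ act Mmod region frobAdm frobLogvol frobΨ frobMmod unitImage ballImage thetaDiv)
    (settingPrVolArchSharp X hlog hc M archPk archSub Ψ act Mmod region n lat sig split qData t tq htq0 htq1) ρ qK hx).trans ?_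
  exact Iff.of_eq (congrArg (fun f => processionNormalized f =
    (settingPrVolArchSharp X hlog hc M archPk archSub Ψ act Mmod region n lat sig split qData t tq htq0 htq1).negLogQ) h3)

/-! ## §2. Norm-transfer output (the q-mover): the Kummer images are the q-pilot regions at every prime, plus `|S^±_{j+1}|·log π` at `∞` -/

/-- **Norm-transfer output, label by label: `Σ_{v_ℚ} vol(Kummer image) = Σ_{v_ℚ} vol(q-region) + |S^±_{j+1}|·log π`.** At a prime the Kummer
image IS the q-pilot region (abc-iut-c312-7 `thetaRegion_eq_qRegion_settingPrVolSharp_of_norm_eq`; same boxes and container as at the trivial-`∞`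
bed), at `∞` it is w5-d163's Step (vii) box of volume `|S^±_{j+1}|·log π` while the `q`-volume is `0`.
[cite: DupuyHilado2025, §3.7, §3.9] [cite: Mochizuki2012, IUTchIV Thm. 1.10 proof Step (vii) p. 30] -/
theorem finsum_logvol_thetaRegion_settingPrVolArchSharp_of_norm_eq (ht0 : ∀ pp i x, t pp i x ≠ 0) (htq0 : ∀ pp x, tq pp x ≠ 0)
    (htq1 : ∀ (pp : Nat.Primes) (x : (thetaIndex X).Fibre (.inr pp)),
      haveI : Fact (pp : ℕ).Prime := ⟨pp.2⟩; placeOf X pp.1 x ∉ X.S → ‖tq pp x‖ = 1)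
    (heq : ∀ (pp : Nat.Primes) (i : Fin X.lstar) (x : (thetaIndex X).Fibre (.inr pp)),
      haveI : Fact (pp : ℕ).Prime := ⟨pp.2⟩; ‖t pp i x‖ = ‖tq pp x‖)
    (i : Fin (thetaIndex X).lstar) :
    ∑ᶠ vQ : (thetaIndex X).VQ,
        ((situationDHVolPrArch X hlog hc M archPk archSub Ψ act Mmod region).D n).logvol (Setting.labelSucc i) vQ
          ((settingPrVolArchSharp X hlog hc M archPk archSub Ψ act Mmod region n lat sig split qData t tq htq0 htq1).thetaRegion 0
            (Setting.labelSucc i) vQ) =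
      (∑ᶠ vQ : (thetaIndex X).VQ,
        (settingPrVolArchSharp X hlog hc M archPk archSub Ψ act Mmod region n lat sig split qData t tq htq0 htq1).qLocal
          (Setting.labelSucc i) vQ) +
        Fintype.card ((thetaIndex X).Caps (Setting.labelSucc i)) * Real.log Real.pi := by
  set P := settingPrVolArchSharp X hlog hc M archPk archSub Ψ act Mmod region n lat sig split qData t tq htq0 htq1 with hP
  -- the archimedean point mass
  set g : (thetaIndex X).VQ → ℝ := fun vQ =>
    match vQ with
    | .inl _ => Fintype.card ((thetaIndex X).Caps (Setting.labelSucc i)) * Real.log Real.pi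
    | .inr _ => 0 with hg
  -- the `q`-volume at `∞` is `0`
  have hq0 : P.qLocal (Setting.labelSucc i) (.inl ()) = 0 := by
    rw [hP, qLocal_settingPrVolArchSharp_eq X hlog hc M archPk archSub Ψ act Mmod region n lat sig split qData t tq htq0 htq1]
    exact qLocal_settingPrVol_qCentreDH_inl X hlog M archPk archSub Ψ act Mmod region n lat sig split qData _ tq htq0 _ _ ()
  have hsplit : ∀ vQ, ((situationDHVolPrArch X hlog hc M archPk archSub Ψ act Mmod region).D n).logvol (Setting.labelSucc i) vQ
      (P.thetaRegion 0 (Setting.labelSucc i) vQ) = P.qLocal (Setting.labelSucc i) vQ + g vQ := by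
    rintro (u | pp)
    · cases u
      rw [hP, logvol_thetaRegion_settingPrVolArchSharp_inl X hlog hc M archPk archSub Ψ act Mmod region n lat sig split qData t tq htq0
        htq1 0 (Setting.labelSucc i), ← hP, hq0, zero_add]
    · -- at a prime: the fourth corner's Θ-box and container ARE the trivial-`∞` bed's; there the Kummer image is the q-region
      have hpr : ((situationDHVolPrArch X hlog hc M archPk archSub Ψ act Mmod region).D n).logvol (Setting.labelSucc i) (.inr pp)
          (P.thetaRegion 0 (Setting.labelSucc i) (.inr pp)) =
        ((situationPrVol X hlog M archPk archSub Ψ act Mmod region).D n).logvol (Setting.labelSucc i) (.inr pp)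
          ((settingPrVolSharp X hlog M archPk archSub Ψ act Mmod region n lat sig split qData tq t htq0 htq1).thetaRegion 0
            (Setting.labelSucc i) (.inr pp)) := rfl
      rw [show g (.inr pp) = 0 from rfl, add_zero, hpr,
        thetaRegion_eq_qRegion_settingPrVolSharp_of_norm_eq X hlog M archPk archSub Ψ act Mmod region n lat sig split qData t ht0 tq
          htq0 htq1 0 i pp (fun x => heq pp i x)]
      rfl
  have hgsupp : (Function.support g).Finite :=
    (Set.finite_range (Sum.inl : Unit → (thetaIndex X).VQ)).subset (by
      rintro (u | pp) hvQ
      · exact ⟨u, rfl⟩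
      · exact absurd rfl hvQ)
  rw [finsum_congr hsplit, finsum_add_distrib (qLocal_support_finite (P := P) (Setting.labelSucc i)) hgsupp,
    finsum_eq_single g (.inl ()) (by
      rintro (u | pp) h
      · cases u
        exact absurd rfl h
      · rfl)]

/-- **Norm-transfer output: the procession volume of the Kummer images is `−|log q| + 𝔼_j |S^±_{j+1}|·log π`** (`= −|log q| + ((l+5)/4)·log π`,
abc-iut-w5-d235 / w5-d241 `processionNormalized_card_caps_log_pi_eq_archLogTheta`). [cite: Mochizuki2012, IUTchIV Thm. 1.10 proof Step (vii) p. 30]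
[cite: DupuyHilado2025, §3.7, §3.9] -/
theorem processionNormalized_thetaRegion_settingPrVolArchSharp_of_norm_eq (ht0 : ∀ pp i x, t pp i x ≠ 0) (htq0 : ∀ pp x, tq pp x ≠ 0)
    (htq1 : ∀ (pp : Nat.Primes) (x : (thetaIndex X).Fibre (.inr pp)),
      haveI : Fact (pp : ℕ).Prime := ⟨pp.2⟩; placeOf X pp.1 x ∉ X.S → ‖tq pp x‖ = 1)
    (heq : ∀ (pp : Nat.Primes) (i : Fin X.lstar) (x : (thetaIndex X).Fibre (.inr pp)),
      haveI : Fact (pp : ℕ).Prime := ⟨pp.2⟩; ‖t pp i x‖ = ‖tq pp x‖) :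
    processionNormalized (fun i : Fin (thetaIndex X).lstar => ∑ᶠ vQ : (thetaIndex X).VQ,
        ((situationDHVolPrArch X hlog hc M archPk archSub Ψ act Mmod region).D n).logvol (Setting.labelSucc i) vQ
          ((settingPrVolArchSharp X hlog hc M archPk archSub Ψ act Mmod region n lat sig split qData t tq htq0 htq1).thetaRegion 0
            (Setting.labelSucc i) vQ)) =
      (settingPrVolArchSharp X hlog hc M archPk archSub Ψ act Mmod region n lat sig split qData t tq htq0 htq1).negLogQ +
        processionNormalized (fun i : Fin (thetaIndex X).lstar =>
          (Fintype.card ((thetaIndex X).Caps (Setting.labelSucc i)) : ℝ) * Real.log Real.pi) := by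
  rw [Setting.negLogQ, ← Repair.CandDupuyHilado31.processionNormalized_add]
  congr 1
  funext i
  exact finsum_logvol_thetaRegion_settingPrVolArchSharp_of_norm_eq X hlog hc M archPk archSub Ψ act Mmod region n lat sig split qData t
    tq ht0 htq0 htq1 heq i

/-! ## §3. The verdicts for norm-transfer output at the honest-`∞` bed -/

/-- **(9-1) AS TYPED IS FALSE FOR EVERY NORM-TRANSFER OUTPUT AT EVERY INPUT at the fourth corner** (any pilot data; `((l+5)/4)·log π > 0`) —
the honest-`∞` NEGATION of gen 2's `RLana91InputConstruction.H_settingPrVolSharp_of_norm_eq` / `H_settingPrVolSharp_qMover` (TRUE at the trivial-`∞`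
bed): the q-mover door to (9-1) is SHUT by the archimedean Θ-term. Decided-as-typed ≠ decided-in-print.
[cite: LANA2026Report, Rmk. 6.2.2 p. 33–34; §9.2 (9-1) p. 46] [cite: Mochizuki2012, IUTchIV Thm. 1.10 proof Step (vii) p. 30] -/
theorem not_H_settingPrVolArchSharp_of_norm_eq (ht0 : ∀ pp i x, t pp i x ≠ 0) (htq0 : ∀ pp x, tq pp x ≠ 0)
    (htq1 : ∀ (pp : Nat.Primes) (x : (thetaIndex X).Fibre (.inr pp)),
      haveI : Fact (pp : ℕ).Prime := ⟨pp.2⟩; placeOf X pp.1 x ∉ X.S → ‖tq pp x‖ = 1)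
    (heq : ∀ (pp : Nat.Primes) (i : Fin X.lstar) (x : (thetaIndex X).Fibre (.inr pp)),
      haveI : Fact (pp : ℕ).Prime := ⟨pp.2⟩; ‖t pp i x‖ = ‖tq pp x‖) :
    ¬ Repair.CandLana1.H
      (LatticeSituation.ofShells (logShellsDH X logv) M archPk archSub (summandPiecesPrArch X hlog hc).Adm
        (summandPiecesPrArch X hlog hc).logvol Ψ act Mmod region frobAdm frobLogvol frobΨ frobMmod unitImage ballImage thetaDiv)
      (settingPrVolArchSharp X hlog hc M archPk archSub Ψ act Mmod region n lat sig split qData t tq htq0 htq1) ρ qK := by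
  rw [H_settingPrVolArchSharp_iff_kummerImage X hlog hc M archPk archSub Ψ act Mmod region frobAdm frobLogvol frobΨ frobMmod unitImage
    ballImage thetaDiv n lat sig split qData t tq ρ qK ht0 htq0 htq1,
    processionNormalized_thetaRegion_settingPrVolArchSharp_of_norm_eq X hlog hc M archPk archSub Ψ act Mmod region n lat sig split qData t
      tq ht0 htq0 htq1 heq, processionNormalized_card_caps_log_pi_eq_archLogTheta X]
  have := ThetaVolumeInput.archLogTheta_pos X.l
  intro h
  linarith

/-- **… WHILE THE ORDER VARIANT HOLDS FOR THAT OUTPUT AT EVERY INPUT, ON ALL PILOT DATA** (shallow or deep): the (Ind3)-enlarged Kummer image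
itself is a global possible image of volume `−|log q| + ((l+5)/4)·log π ≥ −|log q|`. Holds-as-typed ≠ holds-in-print.
[cite: Mochizuki2012, IUTchIV Thm. 1.10 proof Step (vii) p. 30] [cite: DupuyHilado2025, §3.7, §3.9] -/
theorem orderVariant_settingPrVolArchSharp_of_norm_eq (ht0 : ∀ pp i x, t pp i x ≠ 0) (htq0 : ∀ pp x, tq pp x ≠ 0)
    (htq1 : ∀ (pp : Nat.Primes) (x : (thetaIndex X).Fibre (.inr pp)),
      haveI : Fact (pp : ℕ).Prime := ⟨pp.2⟩; placeOf X pp.1 x ∉ X.S → ‖tq pp x‖ = 1)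
    (heq : ∀ (pp : Nat.Primes) (i : Fin X.lstar) (x : (thetaIndex X).Fibre (.inr pp)),
      haveI : Fact (pp : ℕ).Prime := ⟨pp.2⟩; ‖t pp i x‖ = ‖tq pp x‖) :
    OrderVariant
      (LatticeSituation.ofShells (logShellsDH X logv) M archPk archSub (summandPiecesPrArch X hlog hc).Adm
        (summandPiecesPrArch X hlog hc).logvol Ψ act Mmod region frobAdm frobLogvol frobΨ frobMmod unitImage ballImage thetaDiv)
      (settingPrVolArchSharp X hlog hc M archPk archSub Ψ act Mmod region n lat sig split qData t tq htq0 htq1) ρ qK := by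
  set P := settingPrVolArchSharp X hlog hc M archPk archSub Ψ act Mmod region n lat sig split qData t tq htq0 htq1 with hP
  have hvol := processionNormalized_thetaRegion_settingPrVolArchSharp_of_norm_eq X hlog hc M archPk archSub Ψ act Mmod region n lat sig
    split qData t tq ht0 htq0 htq1 heq
  have h3 : (fun i : Fin (thetaIndex X).lstar => ∑ᶠ vQ : (thetaIndex X).VQ,
        ((situationDHVolPrArch X hlog hc M archPk archSub Ψ act Mmod region).D n).logvol (Setting.labelSucc i) vQ
          (P.thetaRegion3 (Setting.labelSucc i) vQ)) =
      fun i : Fin (thetaIndex X).lstar => ∑ᶠ vQ : (thetaIndex X).VQ,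
        ((situationDHVolPrArch X hlog hc M archPk archSub Ψ act Mmod region).D n).logvol (Setting.labelSucc i) vQ
          (P.thetaRegion 0 (Setting.labelSucc i) vQ) := by
    funext i
    refine finsum_congr fun vQ => ?_
    rw [hP, thetaRegion3_settingPrVolArchSharp_eq X hlog hc M archPk archSub Ψ act Mmod region n lat sig split qData t tq htq0 htq1 0]
  have harch : 0 < processionNormalized (fun i : Fin (thetaIndex X).lstar =>
      (Fintype.card ((thetaIndex X).Caps (Setting.labelSucc i)) : ℝ) * Real.log Real.pi) := by
    rw [processionNormalized_card_caps_log_pi_eq_archLogTheta X]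
    exact ThetaVolumeInput.archLogTheta_pos X.l
  refine ⟨⟨fun s => P.thetaRegion3 _ s.2, fun s => P.thetaRegion3_mem_possibleImages _ s.2⟩, ?_⟩
  calc P.negLogQ ≤ P.negLogQ + processionNormalized (fun i : Fin (thetaIndex X).lstar =>
          (Fintype.card ((thetaIndex X).Caps (Setting.labelSucc i)) : ℝ) * Real.log Real.pi) := le_add_of_nonneg_right harch.le
    _ = processionNormalized (fun i : Fin (thetaIndex X).lstar => ∑ᶠ vQ : (thetaIndex X).VQ,
          ((situationDHVolPrArch X hlog hc M archPk archSub Ψ act Mmod region).D n).logvol (Setting.labelSucc i) vQ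
            (P.thetaRegion 0 (Setting.labelSucc i) vQ)) := hvol.symm
    _ = processionNormalized (fun i : Fin (thetaIndex X).lstar => ∑ᶠ vQ : (thetaIndex X).VQ,
          ((situationDHVolPrArch X hlog hc M archPk archSub Ψ act Mmod region).D n).logvol (Setting.labelSucc i) vQ
            (P.thetaRegion3 (Setting.labelSucc i) vQ)) := by rw [h3]

/-- **The pair for the catalogue (RC-639 H2 × RC-667 at the honest-`∞` bed)**: for norm-transfer output at any input and on ALL pilot data, the
ORDER variant holds and (9-1) as typed fails — the genuine honest-`∞` twin of gen 2's toy-model separation `orderVariant_shell_two_and_not_H`,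
realised by a construction rather than by a regime. [cite: LANA2026Report, Rmk. 6.2.2 p. 33–34; §9.2 (9-1) p. 46] -/
theorem orderVariant_and_not_H_settingPrVolArchSharp_of_norm_eq (ht0 : ∀ pp i x, t pp i x ≠ 0) (htq0 : ∀ pp x, tq pp x ≠ 0)
    (htq1 : ∀ (pp : Nat.Primes) (x : (thetaIndex X).Fibre (.inr pp)),
      haveI : Fact (pp : ℕ).Prime := ⟨pp.2⟩; placeOf X pp.1 x ∉ X.S → ‖tq pp x‖ = 1)
    (heq : ∀ (pp : Nat.Primes) (i : Fin X.lstar) (x : (thetaIndex X).Fibre (.inr pp)),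
      haveI : Fact (pp : ℕ).Prime := ⟨pp.2⟩; ‖t pp i x‖ = ‖tq pp x‖) :
    OrderVariant
        (LatticeSituation.ofShells (logShellsDH X logv) M archPk archSub (summandPiecesPrArch X hlog hc).Adm
          (summandPiecesPrArch X hlog hc).logvol Ψ act Mmod region frobAdm frobLogvol frobΨ frobMmod unitImage ballImage thetaDiv)
        (settingPrVolArchSharp X hlog hc M archPk archSub Ψ act Mmod region n lat sig split qData t tq htq0 htq1) ρ qK ∧
      ¬ Repair.CandLana1.H
        (LatticeSituation.ofShells (logShellsDH X logv) M archPk archSub (summandPiecesPrArch X hlog hc).Adm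
          (summandPiecesPrArch X hlog hc).logvol Ψ act Mmod region frobAdm frobLogvol frobΨ frobMmod unitImage ballImage thetaDiv)
        (settingPrVolArchSharp X hlog hc M archPk archSub Ψ act Mmod region n lat sig split qData t tq htq0 htq1) ρ qK :=
  ⟨orderVariant_settingPrVolArchSharp_of_norm_eq X hlog hc M archPk archSub Ψ act Mmod region frobAdm frobLogvol frobΨ frobMmod unitImage
      ballImage thetaDiv n lat sig split qData t tq ρ qK ht0 htq0 htq1 heq,
    not_H_settingPrVolArchSharp_of_norm_eq X hlog hc M archPk archSub Ψ act Mmod region frobAdm frobLogvol frobΨ frobMmod unitImage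
      ballImage thetaDiv n lat sig split qData t tq ρ qK ht0 htq0 htq1 heq⟩

end GenuineArch

end Summit.ABC.IUTFork.Repair.RLana91InputConstructionArchCorner

end
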